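import Summits.NavierStokesRegularity.FluidComputer.BlockPairSupport
import Literature.Analysis.FluidPDE.TaoAveragedRealParts
import Literature.Analysis.FluidPDE.TaoCascadeProjection

/-!
# Block design — PARITY: every true-Euler triad among the design modes vanishes
(bp3 gen 41, ASSEMBLY §2g.9(ab))

HONEST FRAMING: low prior, high value-of-information experiment on Tao's machine paradigm; NOT a
claim that NS blows up. Design level only: the content of this file is the vanishing of
explicit pairings; it proves nothing about blow-up and asserts no residue.

[folklore] Tao's wavelet data (`CascadeWaveletData ε₀ m`; Tao 2016 §4 p. 21: "let `ψᵢ` … be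
Schwartz with Fourier transform REAL-VALUED and supported on `Bᵢ ∪ -Bᵢ`") consists of real
profiles with pointwise-real Fourier transforms — real EVEN fields — and the dilations
`ψ_{i,n} = Dil_{(1+ε₀)ⁿ} ψᵢ` preserve both properties (`isFourierReal_cascadeWavelet`, accepted
`isReal_cascadeWavelet`). For three fields with pointwise-real Fourier transforms the integrand of
Tao's (1.3), `⟨B(u,v),w⟩ = -πi ∫∫ Λ_{ξ₁,ξ₂}(û(ξ₁), v̂(ξ₂), ŵ(-ξ₁-ξ₂))`, is real (`Λ` has real
coefficients, `Λ_im_eq_zero`), so the double integral is real and `⟨B(u,v),w⟩` is purely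
imaginary: `Re⟨B(u,v),w⟩ = 0` (`eulerForm_re_of_isFourierReal`; conjugation commutes with the
Bochner integral unconditionally, no integrability needed). For real fields the form is real
(accepted `eulerForm_im_of_isFourierHermitian`, Tao §3.1 p. 15), hence it VANISHES
(`eulerForm_eq_zero_of_isReal_of_isFourierReal`). In `x`-space: `B(even, even)` is odd (one
derivative; the Leray projection preserves parity), hence `L²`-orthogonal to every even field.

CONSEQUENCES (every `CascadeWaveletData ε₀ m`, all profiles, all scales; in particular the design
modes `mode 𝒟 n = ψ_{0,n}` of `BlockReadout` and the clean design states `recon n (a, b)`):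
* `eulerForm_cascadeWavelet_eq_zero_of_parity` : `⟨B(ψ_{i,n₁}, ψ_{j,n₂}), ψ_{k,n₃}⟩ = 0` for ALL
  index triples — not only the backscatter triad of `BlockPairSupport` (there by frequency
  bookkeeping) but also the FORWARD triad `κ_n = Re⟨B(ψ_n,ψ_n), ψ_{n+1}⟩` (`eulerForm_mode`,
  `re_eulerForm_mode_mode_succ`) and every cross pairing;
* `eulerForm_recon_recon_mode` : `⟨B(a,a), ψ_m⟩ = 0` at every clean two-mode state
  `a = recon n p`, for every block `m`: the two-mode Galerkin–Navier–Stokes field of the pair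
  `(ψ_n, ψ_{n+1})` has NO exchange term — it is pure viscous decay `(A,B) ↦ (-Λ_n A, -Λ_{n+1} B)`;
  the coupling an inhabited residue pins the design to, `k = unit n · E_n κ_n/√E_{n+1}`
  (`BlockReachRigidity`, ASK 98), is `0`, and the supercriticality `E_n κ_n aLo > √E_{n+1} Λ_{n+1}`
  that the hand-off needs along the pinned field (`BlockPairStall`) fails for EVERY design of the
  class at EVERY Reynolds number (`0 <` a positive number is what it would require of `κ_n = 0`).

HONEST READING. (1) This says the true Euler nonlinearity maps the span of the design modes into
ODD fields, orthogonal to that span (junk, in the lane's ledger) — NOT that the nonlinearity is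
small: `B(ψ_n, ψ_n)` is a nonzero odd field in general. (2) It is harmless for Tao's AVERAGED
equation: the averaging (§1.1 p. 6) runs over real order-zero multipliers `m(-ξ) = \overline{m(ξ)}`,
which include odd purely-imaginary symbols (Riesz type) that map even fields to odd ones and
restore the triads; it obstructs only the use of this wavelet class VERBATIM as the mode system of
a design driven by the TRUE bilinear form. (3) Profiles with complex (non-even) Fourier transforms
are not `CascadeWaveletData` as typed (field `fourier_im`); nothing is claimed about them here.

## References

* T. Tao, *Finite time blowup for an averaged three-dimensional Navier–Stokes equation*, J. Amer.
  Math. Soc. 29 (2016) 601–674 = arXiv:1402.0290v3, (1.3)–(1.4), §1.1 p. 6, §3.1 p. 15, §4 p. 21.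
  [Tao2016AveragedNS]
-/

noncomputable section

open MeasureTheory Set Filter Topology Metric
open scoped ENNReal NNReal ComplexConjugate

namespace Summit.NavierStokesRegularity.FluidComputer

open Literature.Analysis.FluidPDE.Tao2016
open Literature.Analysis.FluidPDE.FluidComputer

namespace BlockDesign

local notation "ℝ³" => EuclideanSpace ℝ (Fin 3)
local notation "ℂ³" => EuclideanSpace ℂ (Fin 3)

/-! ## Real vectors make Tao's symbol real -/

/-- Tao's symbol `Λ_{ξ₁,ξ₂}(X₁,X₂,X₃)` of (1.4) is REAL on vectors with real coordinates (its
coefficients are the real frequencies). [cite: Tao2016AveragedNS, (1.4)] -/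
theorem Λ_im_eq_zero (ξ₁ ξ₂ : ℝ³) {X₁ X₂ X₃ : ℂ³} (h₁ : ∀ k, (X₁ k).im = 0)
    (h₂ : ∀ k, (X₂ k).im = 0) (h₃ : ∀ k, (X₃ k).im = 0) : (Λ ξ₁ ξ₂ X₁ X₂ X₃).im = 0 := by
  have h := conj_Λ ξ₁ ξ₂ X₁ X₂ X₃
  rw [conj3_eq_self_of_im_eq_zero h₁, conj3_eq_self_of_im_eq_zero h₂,
    conj3_eq_self_of_im_eq_zero h₃] at h
  exact Complex.conj_eq_iff_im.1 h

/-! ## Fields with pointwise-real Fourier transform (even real fields) -/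

/-- `û(ξ)` has real coordinates for a.e. `ξ` — for a real field this is evenness, `u(-x) = u(x)`;
Tao's profiles have it by fiat (§4 p. 21). [cite: Tao2016AveragedNS, §4 p. 21] -/
def IsFourierReal (u : L2C) : Prop :=
  ∀ᵐ ξ ∂(volume : Measure ℝ³), ∀ k, (fourierFn u ξ k).im = 0

/-- `IsFourierReal` is stable under real scalar multiples. [folklore] -/
theorem IsFourierReal.smul {u : L2C} (hu : IsFourierReal u) (r : ℝ) :
    IsFourierReal ((r : ℂ) • u) := by
  unfold IsFourierReal at hu ⊢
  filter_upwards [fourierFn_smul (r : ℂ) u, hu] with ξ h1 h2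
  intro k
  rw [h1, PiLp.smul_apply, smul_eq_mul, Complex.mul_im, Complex.ofReal_re, Complex.ofReal_im,
    h2 k, mul_zero, zero_mul, add_zero]

/-- `IsFourierReal` is stable under sums. [folklore] -/
theorem IsFourierReal.add {u v : L2C} (hu : IsFourierReal u) (hv : IsFourierReal v) :
    IsFourierReal (u + v) := by
  unfold IsFourierReal at hu hv ⊢
  filter_upwards [fourierFn_add u v, hu, hv] with ξ h1 h2 h3
  intro k
  rw [h1, PiLp.add_apply, Complex.add_im, h2 k, h3 k, add_zero]

/-- **Tao's wavelets have pointwise-real Fourier transforms**: `ψ̂_{i,n}(ξ) = c^{3/2} |c³|⁻¹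
ψ̂ᵢ(ξ/c)`, `c = (1+ε₀)ⁿ` (accepted `fourierFn_cascadeWavelet`), with `ψ̂ᵢ` real-valued (field
`fourier_im`). [cite: Tao2016AveragedNS, §4 p. 21 + Def. 3.1] -/
theorem isFourierReal_cascadeWavelet {ε₀ : ℝ} {m : ℕ} (hε : 0 < 1 + ε₀)
    (𝒟 : CascadeWaveletData ε₀ m) (i : Fin m) (n : ℤ) :
    IsFourierReal (cascadeWavelet ε₀ (𝒟.ψ i) n) := by
  unfold IsFourierReal
  filter_upwards [fourierFn_cascadeWavelet hε (𝒟.ψ i) n] with ξ hξ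
  intro k
  rw [hξ, PiLp.smul_apply, PiLp.smul_apply, smul_eq_mul, Complex.mul_im, Complex.ofReal_re,
    Complex.ofReal_im, zero_mul, add_zero, Complex.smul_im, smul_eq_mul, 𝒟.fourier_im i,
    mul_zero, mul_zero]

/-! ## The parity lemma -/

/-- **`Re⟨B(u,v),w⟩ = 0` when `û, v̂, ŵ` are pointwise real**: the integrand of (1.3) is real
a.e. (`Λ_im_eq_zero`), so `J = ∫∫ Λ(û(ξ₁), v̂(ξ₂), ŵ(-ξ₁-ξ₂))` obeys `\overline{J} = J`
(conjugation commutes with the Bochner integral; junk `0` is real too) and `-πi J` has zero real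
part. [folklore] -/
theorem eulerForm_re_of_isFourierReal {x y z : L2C} (hx : IsFourierReal x) (hy : IsFourierReal y)
    (hz : IsFourierReal z) : (eulerForm x y z).re = 0 := by
  set F : ℝ³ × ℝ³ → ℂ := fun p =>
    Λ p.1 p.2 (fourierFn x p.1) (fourierFn y p.2) (fourierFn z (-p.1 - p.2)) with hF
  set J : ℂ := ∫ p, F p with hJ
  have hae : ∀ᵐ p : ℝ³ × ℝ³ ∂volume, conj (F p) = F p := by
    have h1 : ∀ᵐ p : ℝ³ × ℝ³ ∂volume, ∀ k, (fourierFn x p.1 k).im = 0 := by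
      rw [Measure.volume_eq_prod]
      exact (Measure.quasiMeasurePreserving_fst (μ := volume) (ν := volume)).ae hx
    have h2 : ∀ᵐ p : ℝ³ × ℝ³ ∂volume, ∀ k, (fourierFn y p.2 k).im = 0 := by
      rw [Measure.volume_eq_prod]
      exact (Measure.quasiMeasurePreserving_snd (μ := volume) (ν := volume)).ae hy
    have h3 : ∀ᵐ p : ℝ³ × ℝ³ ∂volume, ∀ k, (fourierFn z (-p.1 - p.2) k).im = 0 :=
      quasiMeasurePreserving_neg_sub.ae hz
    filter_upwards [h1, h2, h3] with p e1 e2 e3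
    exact Complex.conj_eq_iff_im.2 (Λ_im_eq_zero p.1 p.2 e1 e2 e3)
  have hconj : conj J = J := by
    rw [hJ, ← integral_conj, integral_congr_ae hae]
  have him : J.im = 0 := Complex.conj_eq_iff_im.1 hconj
  change (-(Real.pi * Complex.I) * J).re = 0
  simp [Complex.mul_re, him]

/-- **The Euler triad of real even fields VANISHES**: real part zero by parity
(`eulerForm_re_of_isFourierReal`), imaginary part zero because the fields are real (accepted
`eulerForm_im_of_isFourierHermitian`). [folklore] -/
theorem eulerForm_eq_zero_of_isReal_of_isFourierReal {x y z : L2C} (hx : IsReal x)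
    (hy : IsReal y) (hz : IsReal z) (hx' : IsFourierReal x) (hy' : IsFourierReal y)
    (hz' : IsFourierReal z) : eulerForm x y z = 0 :=
  Complex.ext (by rw [eulerForm_re_of_isFourierReal hx' hy' hz', Complex.zero_re])
    (by rw [eulerForm_im_of_isFourierHermitian hx.isFourierHermitian hy.isFourierHermitian
      hz.isFourierHermitian, Complex.zero_im])

/-- **Every true-Euler triad among Tao's wavelets vanishes**:
`⟨B(ψ_{i,n₁}, ψ_{j,n₂}), ψ_{k,n₃}⟩ = 0` for all profiles `i, j, k` and all scales `n₁, n₂, n₃` of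
every `CascadeWaveletData ε₀ m`. [cite: Tao2016AveragedNS, (1.3) + §4 p. 21] -/
theorem eulerForm_cascadeWavelet_eq_zero_of_parity {ε₀ : ℝ} {m : ℕ} (hε : 0 < 1 + ε₀)
    (𝒟 : CascadeWaveletData ε₀ m) (i j k : Fin m) (n₁ n₂ n₃ : ℤ) :
    eulerForm (cascadeWavelet ε₀ (𝒟.ψ i) n₁) (cascadeWavelet ε₀ (𝒟.ψ j) n₂)
      (cascadeWavelet ε₀ (𝒟.ψ k) n₃) = 0 :=
  eulerForm_eq_zero_of_isReal_of_isFourierReal (isReal_cascadeWavelet ε₀ _ _)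
    (isReal_cascadeWavelet ε₀ _ _) (isReal_cascadeWavelet ε₀ _ _)
    (isFourierReal_cascadeWavelet hε 𝒟 i n₁) (isFourierReal_cascadeWavelet hε 𝒟 j n₂)
    (isFourierReal_cascadeWavelet hε 𝒟 k n₃)

/-! ## The lane's design modes and clean states -/

section Lane

variable (𝒟 : CascadeWaveletData 1 1) (S : CascadeSpecs)

/-- The design modes are real fields. [folklore] -/
theorem isReal_mode (n : ℕ) : IsReal (mode 𝒟 n) := isReal_cascadeWavelet 1 _ _

/-- The design modes have pointwise-real Fourier transforms (they are even). [cite: Tao2016AveragedNS, §4 p. 21] -/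
theorem isFourierReal_mode (n : ℕ) : IsFourierReal (mode 𝒟 n) :=
  isFourierReal_cascadeWavelet two_pos' 𝒟 0 (n : ℤ)

/-- **Every triad of design modes vanishes**: `⟨B(ψ_a, ψ_b), ψ_c⟩ = 0` for all blocks
`a, b, c`. [folklore] -/
theorem eulerForm_mode (a b c : ℕ) : eulerForm (mode 𝒟 a) (mode 𝒟 b) (mode 𝒟 c) = 0 :=
  eulerForm_cascadeWavelet_eq_zero_of_parity two_pos' 𝒟 0 0 0 _ _ _

/-- In particular the lane's FORWARD transfer coefficient vanishes identically:
`κ_n = Re⟨B(ψ_n, ψ_n), ψ_{n+1}⟩ = 0` for every admissible design and every block (this is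
`fwdCoef 𝒟 n` of `BlockReachRigidity`). [folklore] -/
theorem re_eulerForm_mode_mode_succ (n : ℕ) :
    (eulerForm (mode 𝒟 n) (mode 𝒟 n) (mode 𝒟 (n + 1))).re = 0 := by
  rw [eulerForm_mode, Complex.zero_re]

/-- Clean design states are real fields. [folklore] -/
theorem isReal_recon (n : ℕ) (p : ℝ × ℝ) : IsReal (recon 𝒟 S n p) :=
  ((isReal_mode 𝒟 n).smul _).add ((isReal_mode 𝒟 (n + 1)).smul _)

/-- Clean design states have pointwise-real Fourier transforms. [folklore] -/
theorem isFourierReal_recon (n : ℕ) (p : ℝ × ℝ) : IsFourierReal (recon 𝒟 S n p) :=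
  ((isFourierReal_mode 𝒟 n).smul _).add ((isFourierReal_mode 𝒟 (n + 1)).smul _)

/-- **No exchange at any clean two-mode state**: `⟨B(a, a), ψ_m⟩ = 0` for `a = recon n (A, B) =
A√E_n ψ_n + B√E_{n+1} ψ_{n+1}` and every block `m` — the two-mode Galerkin–Navier–Stokes field of
the pair `(ψ_n, ψ_{n+1})` is pure viscous decay; the residue-pinned coupling `k` is `0`. [folklore] -/
theorem eulerForm_recon_recon_mode (n : ℕ) (p : ℝ × ℝ) (m : ℕ) :
    eulerForm (recon 𝒟 S n p) (recon 𝒟 S n p) (mode 𝒟 m) = 0 :=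
  eulerForm_eq_zero_of_isReal_of_isFourierReal (isReal_recon 𝒟 S n p) (isReal_recon 𝒟 S n p)
    (isReal_mode 𝒟 m) (isFourierReal_recon 𝒟 S n p) (isFourierReal_recon 𝒟 S n p)
    (isFourierReal_mode 𝒟 m)

/-- Real-part form used by the lane's readout fields (`nsVF` of `BlockReachRigidity`): the
nonlinear part of both readout derivatives at a clean state is `0`. [folklore] -/
theorem re_eulerForm_recon_recon_mode (n : ℕ) (p : ℝ × ℝ) (m : ℕ) :
    (eulerForm (recon 𝒟 S n p) (recon 𝒟 S n p) (mode 𝒟 m)).re = 0 := by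
  rw [eulerForm_recon_recon_mode, Complex.zero_re]

end Lane

end BlockDesign

end Summit.NavierStokesRegularity.FluidComputer
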